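import Literature.NumberTheory.EllipticCurves.KatoFineSelmerFiniteProofs
import Literature.NumberTheory.EllipticCurves.GaloisAction
import HarnessLib

/-!
# `X₀(E/ℚ_∞) = Sel₀(ℚ_∞, E[p^∞])^∨` is a TORSION `Λ`-module (Kato 2004, Thm. 12.4 (1), as restated
# for the fine Selmer group by C.-H. Kim, Amer. J. Math. 148 (2026), Thm. 4.5 (2)) — one named fact,
# in the hypotheses of its refereed printed form: `E/ℚ`, `p ≥ 5`, `ρ̄_{E,p}` surjective

Topic `NumberTheory/EllipticCurves`; namespace `Literature.NumberTheory.EllipticCurves`. Companion of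
`KatoFineSelmerDual` (the Pontryagin-dual datum `WeierstrassCurve.FineSelmerDualData`, whose module
docstring names this torsion statement as the right-hand side of Kato's main conjecture without
`p`-adic `L`-functions) and of `KatoFineSelmerFiniteProofs` (`FineSelmerDualData.module_finite`:
`X₀` is finitely generated over `Λ` — a THEOREM of the tree). Written by the cross-ladder
literature-typing layer (cell `bsd-littype`, seat 09, gen 3; its OPEN-QUESTIONS-09 Q14): the torsion
half of "finitely generated torsion" existed in the tree only as a FIELD (`isTorsion_fine` of
`Kobayashi2003.EtaColemanPoitouTateData`), never as a statement. HONEST FRAMING: a named fact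
(`def … : Prop`, D-0014), nothing asserted, no `_holds` (the proof is Kato's Euler-system bound for
`𝐇²`, §§13–14 of Astérisque 295 — size XL); typed ≠ proved ≠ endorsed.

## The printed statements

* C.-H. Kim, *The structure of Selmer groups and the Iwasawa main conjecture for elliptic curves*,
  Amer. J. Math. 148 (2026) 79–129 = arXiv:2203.12159 (held store text, v1–v3 numbering; journal
  Thm. 4.5 = store Thm. 4.6, NUMBERING NOTE of `KuriharaNumberKimStructure`), §4.1 "The
  Iwasawa-theoretic set up", chunk p0020: standing hypotheses "Let `E` be an elliptic curve over `ℚ`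
  of conductor `N` and `p ≥ 5` a prime" (§1.2, p0005:L18) and "Throughout this section, we assume
  that `ρ̄` is surjective" (p0020:L3); `ℚ_∞` the cyclotomic `ℤ_p`-extension, `Λ = ℤ_p⟦Gal(ℚ_∞/ℚ)⟧`
  (p0020:L9–L12). **Theorem 4.6 (Kato)** (p0020:L88–L99): "(1) If `ρ̄` is irreducible, then
  `Sel_{𝓕_Λ}(ℚ, T ⊗ Λ) = H¹(ℚ, T ⊗ Λ)` is free of rank one over `Λ`. (2)
  `Sel_{𝓕_Λ^*}(ℚ, (T ⊗ Λ)^*) = Sel₀(ℚ_∞, E[p^∞])` is a co-finitely generated co-torsion `Λ`-module.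
  Proof. See [kato-euler-systems]. See also [mazur-rubin-book]."
* K. Kato, Astérisque 295 (2004), Thm. 12.4 (1) (p. 221): "`𝐇²(T)` is a torsion `Λ`-module" for every
  `Gal(ℚ̄/ℚ)`-stable lattice `T` of `V_{F_λ}(f)` (no hypothesis on the reduction at `p`); the fine
  Selmer dual embeds into `𝐇²(T)` by Poitou–Tate duality — the source of (2). Clause (1) for `T_pE`
  is the tree's named fact `Kato2004.thm12_4` (file `Kato2004/IwasawaCohomology`) and is not
  restated. The same torsion statement at a supersingular `p` with `a_p = 0` is S. Kobayashi, Invent.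
  Math. 152 (2003), Cor. 7.2 (a field of the tree's `Kobayashi2003.EtaColemanPoitouTateData`), and for
  newforms with large image it is C.-H. Kim, arXiv:2505.09121v1, Thm. 3.16 (2) (preprint).

## The Lean statement

VERBATIM the refereed clause (2), in the tree's vocabulary: `W/ℚ` an elliptic curve
(`[W.IsElliptic]`; any model — the statement is isomorphism-invariant), `p ≥ 5`, `ρ̄_{E,p}`
surjective (`W.HasSurjectiveModNGaloisRep p`), `κ` the cyclotomic `ℤ_p`-extension of `ℚ`
(`κ.IsCyclotomic`) with a topological generator `γ` (`κ.IsTopGenerator γ`, so that `T = γ − 1`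
generates the augmentation ideal and `Λ = ℤ_p⟦T⟧` is Kim's `Λ`), `Y` ANY Pontryagin-dual datum of
`Sel₀(ℚ_∞, E[p^∞])` (`W.FineSelmerDualData κ γ`; all such are `Λ`-isomorphic); conclusion
`Module.IsTorsion Λ Y.X`. Finite generation is NOT restated (theorem `FineSelmerDualData.module_finite`).
Weaker than Kato's theorem (which needs neither `p ≥ 5` nor surjectivity), never stronger than
either source. -- TODO(general form): every prime `p` and every `E/ℚ` (Kato Thm. 12.4 (1) +
Poitou–Tate), newforms of weight `k ≥ 2` (Kim 2025 Thm. 3.16 (2)).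

## References
* C.-H. Kim, Amer. J. Math. 148 (2026) 79–129 = arXiv:2203.12159, §1.2 (p ≥ 5), §4.1 (standing
  surjectivity), Thm. 4.5 (2) (journal) = Thm. 4.6 (2) (arXiv v1–v4). [Kim2022StructureSelmer]
* K. Kato, Astérisque 295 (2004), §12.2 (12.2.1), Thm. 12.4 (1) (p. 221), §13.8. [Kato2004Asterisque]
* B. Mazur, K. Rubin, *Kolyvagin systems*, Mem. AMS 799 (2004), §5.3 (the `Λ`-adic Selmer
  structure `𝓕_Λ`). [MazurRubin2004]
* S. Kobayashi, Invent. Math. 152 (2003), Cor. 7.2. [Kobayashi2003]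
-/

noncomputable section

open scoped Classical

open Literature.NumberTheory.EllipticCurves

namespace Literature.NumberTheory.EllipticCurves

/-- **Kim 2022 (Amer. J. Math. 148), Thm. 4.5 (2) [= arXiv Thm. 4.6 (2)] (Kato 2004, Thm. 12.4 (1)
for `𝐇²(T_pE)` with Poitou–Tate): the dual fine Selmer group `X₀(E/ℚ_∞) = Sel₀(ℚ_∞, E[p^∞])^∨` is a
torsion `Λ`-module**, stated in the hypotheses of the refereed printed clause: `E/ℚ` an elliptic
curve, `p ≥ 5`, `ρ̄_{E,p}` surjective ("Let `E` be an elliptic curve over `ℚ` … and `p ≥ 5` a prime";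
"Throughout this section, we assume that `ρ̄` is surjective"; "`Sel₀(ℚ_∞, E[p^∞])` is a co-finitely
generated co-torsion `Λ`-module"), for the cyclotomic `ℤ_p`-extension `κ` with topological generator
`γ` and EVERY Pontryagin-dual datum `Y` (`Λ = ℤ_p⟦T⟧`, `T = γ − 1`). No hypothesis on the reduction of
`E` at `p` (good ordinary, supersingular, multiplicative and additive all allowed, as printed). The
"co-finitely generated" half is the tree theorem `WeierstrassCurve.FineSelmerDualData.module_finite`.
Named fact; nothing asserted; size XL (Kato §§12–14); weaker than Kato's Thm. 12.4 (1), never stronger.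
[cite: Kim2022StructureSelmer, Thm. 4.5 (2) (journal) = Thm. 4.6 (2) (arXiv v1–v4, store chunk p0020:L88–L99), with §1.2 (p0005:L18) and §4.1 (p0020:L3) for the standing hypotheses]
[cite: Kato2004Asterisque, Thm. 12.4 (1) (p. 221)] -/
def Kim2022_fineSelmerDual_isTorsion : Prop :=
  ∀ (W : WeierstrassCurve ℚ) [W.IsElliptic] (p : ℕ) [Fact p.Prime], 5 ≤ p →
    W.HasSurjectiveModNGaloisRep p →
    ∀ (κ : ZpExtension ℚ p) (γ : Field.absoluteGaloisGroup ℚ), κ.IsCyclotomic →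
      κ.IsTopGenerator γ →
    ∀ Y : W.FineSelmerDualData κ γ, Module.IsTorsion (IwasawaAlgebra p) Y.X

/-- Reading for the large-image statements of the tree (`Kim2025/*`, `kato_divisibility` (3)): the
tower hypothesis "`ρ̄_{E,p^n}` onto for every `n`" contains the printed "`ρ̄_{E,p}` surjective" (level
`n = 1`), so the fact applies. [cite: Kim2022StructureSelmer, §4.1 (store chunk p0020:L3)] -/
theorem fineSelmerDual_isTorsion_of_tower (h : Kim2022_fineSelmerDual_isTorsion)
    (W : WeierstrassCurve ℚ) [W.IsElliptic] (p : ℕ) [Fact p.Prime] (hp : 5 ≤ p)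
    (htower : ∀ n : ℕ, W.HasSurjectiveModNGaloisRep (p ^ n : ℕ))
    {κ : ZpExtension ℚ p} {γ : Field.absoluteGaloisGroup ℚ} (hκ : κ.IsCyclotomic)
    (hγ : κ.IsTopGenerator γ) (Y : W.FineSelmerDualData κ γ) :
    Module.IsTorsion (IwasawaAlgebra p) Y.X :=
  h W p hp (by simpa using htower 1) κ γ hκ hγ Y

/-- With the tree theorem `FineSelmerDualData.module_finite`: under the fact, `X₀(E/ℚ_∞)` is a
finitely generated torsion `Λ`-module — the full printed clause "co-finitely generated co-torsion".
[cite: Kim2022StructureSelmer, Thm. 4.5 (2) (journal) = Thm. 4.6 (2) (arXiv, store chunk p0020:L95)] -/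
theorem fineSelmerDual_finite_and_isTorsion (h : Kim2022_fineSelmerDual_isTorsion)
    (W : WeierstrassCurve ℚ) [W.IsElliptic] (p : ℕ) [Fact p.Prime] (hp : 5 ≤ p)
    (hsurj : W.HasSurjectiveModNGaloisRep p)
    {κ : ZpExtension ℚ p} {γ : Field.absoluteGaloisGroup ℚ} (hκ : κ.IsCyclotomic)
    (hγ : κ.IsTopGenerator γ) (Y : W.FineSelmerDualData κ γ) :
    Module.Finite (IwasawaAlgebra p) Y.X ∧ Module.IsTorsion (IwasawaAlgebra p) Y.X :=
  ⟨WeierstrassCurve.FineSelmerDualData.module_finite W κ hγ Y, h W p hp hsurj κ γ hκ hγ Y⟩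

/-! ## The general form: every elliptic curve over `ℚ`, every prime `p` (Kato 2004, Thm. 12.4 (1)
composed with the Poitou–Tate sequence (17.13.1) = `lim←` of (14.9.3)) — appended by the typing layer
(cell `bsd-littype`, seat 09, gen 4) on the cite-line RULING of `bsd-cited-lead` (168)(2)
(2026-08-27T01:16Z) with the locator pair confirmed first-hand by ARM P reader r01 (S4-LIGHT one-liner,
2026-08-27T01:23Z): "(L1) Kato Astérisque 295 Thm 12.4 (1) p. 221 ∘ (L2) Kato (17.13.1) p. 279 (= lim←
over `ℚ(ζ_{p^n})` of (14.9.3) p. 240; §14.1 p. 235 for `H¹_f` and `S = Sel`) — `Coker(𝐇¹_loc/lim H¹_f →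
𝔛) = X₀` (strict-at-`p` = fine: `H¹_f(K_v, E[p^∞]) = 0` at `v ∤ p`) `↪ 𝐇²(T)`, «exact if `p ≠ 2`, and
exact upto `×2` in the case `p = 2`» `⇒ X₀` torsion by 12.4 (1)".  The scoped fact
`Kim2022_fineSelmerDual_isTorsion` above (the refereed VERBATIM sentence of Kim AJM 148 under its §4
standing hypotheses `p ≥ 5`, `ρ̄` onto) is KEPT unchanged; the general form is a NEW name, as ruled.

The printed statements used (K. Kato, Astérisque 295 (2004); `[p. N]` = printed page = file page
`N − 115` of the held text `paper:url-37fbba0bb64a`, re-read by this seat 2026-08-27):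
* **Thm. 12.4 (1) [p. 221, p0106:L9–L10]** "Take any `Gal(ℚ̄/ℚ)`-stable `O_λ`-lattice `T` of `V_{F_λ}`.
  Then: (1) `𝐇²(T)` is a torsion `Λ`-module." (`Λ = O_λ[[G_∞]]`, `G_∞ = Gal(ℚ(ζ_{p^∞})/ℚ)`, p. 221 L5;
  no hypothesis on `p` or on the reduction of `f` at `p`.)
* **§17.13 (17.13.1) [p. 279, p0164:L18–L29]** "Let `T` be a `Gal(ℚ̄/ℚ)`-stable `O_λ`-lattice of
  `V_{F_λ}(f)`. Take any integer `r` such that `1 ≤ r ≤ k − 1`. By taking `lim←_n` of the sequence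
  (14.9.3) for `K = ℚ(ζ_{p^n})` and for `T(r)` …, and by using (17.10.1), we obtain a sequence of
  `Λ`-modules (17.13.1) `0 → 𝐇¹(T(k))/(lim←_n H¹_f(ℤ[ζ_{p^n}, 1/p], T(r))(k−r)) → 𝐇¹_loc(T(k))/(lim←_n
  H¹_f(ℚ_p(ζ_{p^n}), T(r))(k−r)) → 𝔛(T*(1−k)) → 𝐇²(T(k)) → 𝐇²_loc(T(k))` (`T* = Hom_{O_λ}(T, O_λ)`)
  which is exact if `p ≠ 2`, and is exact upto `×2` in the case `p = 2`."
* **(14.9.3) [p. 240, p0125:L2–L15]** the finite-level Poitou–Tate sequence `0 → H¹(O_K[1/p], T)/H¹_f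
  → H¹(K ⊗ ℚ_p, T)/H¹_f(K ⊗ ℚ_p, T) → S(K, T*(1))^∨ → H²(O_K[1/p], T) → H²(K ⊗ ℚ_p, T) → …` "which
  are exact in the case `p ≠ 2`, and exact upto `×2` in the case `p = 2`"; **§14.1 [p. 235,
  p0120:L3–L12]** the Bloch–Kato local conditions `H¹_f(K_v, V)` (`= 0` for `v` archimedean, the
  unramified classes at finite `v ∤ p`, the crystalline classes at `v ∣ p`) and `Sel(K, T)`.
READING (the composite, two printed steps and one standard passage — exactly the lines of the ruling):
for `T = T_pE` (`k = 2`, `r = 1`, `T*(1−k) ≅ T_pE ⊗ …`, i.e. `𝔛 = X(E/ℚ(ζ_{p^∞})) = Sel_{p^∞}^∨`) the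
dual FINE Selmer group is the cokernel of the second arrow of (17.13.1) — `Sel₀ ⊂ Sel` is the kernel of
the localisation at `p`, and at `v ∤ p` the Kummer condition over the tower is already "locally trivial",
so `X₀ = 𝔛 / Im(𝐇¹_loc)` — hence `X₀(E/ℚ(ζ_{p^∞}))` embeds into `𝐇²(T)` (up to a kernel killed by `2`
when `p = 2`), a torsion `Λ`-module by Thm. 12.4 (1); the passage from Kato's tower `ℚ(ζ_{p^∞})` to the
cyclotomic `ℤ_p`-extension `ℚ_∞` (`Δ`-invariants for `p` odd, `#Δ = p − 1` prime to `p`; restriction /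
corestriction of index `2` for `p = 2`) is the one spelled out in `Kato2004/IwasawaH2Descent.lean`,
module docstring READING (i)/(ii), where Kato's `𝐇²` itself is packaged for EVERY `E/ℚ` and EVERY `p`
(`Kato2004.IwasawaH2Data.isTorsion_H2`, fact `Kato2004.nonempty_iwasawaH2Data`; Burungale–Skinner,
App. A to arXiv:2210.10730, §10.1.1 print the `ℤ_p⟦Γ⟧`-form "finitely-generated torsion `Λ`-module" for
an arbitrary `E/ℚ` and an arbitrary prime).  That package deliberately carries NO comparison map
`X₀ → 𝐇²_Γ` (its "What is NOT here"), so the torsion of `X₀` does not follow from it inside the tree: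
this is the statement-level complement.  Referee flag: `Kato-12.4(1)-17.13.1-fine-reading` (non-verbatim
steps: identification of `Coker` with `X₀`; tower-to-`Γ` passage; the `×2` clause at `p = 2`, which does
not affect torsion).  Consumers: every `(hY : Module.IsTorsion Λ Y.X)` binder on a
`W.FineSelmerDualData κ γ` in the tree — e.g. the `p = 2` Coleman road
`Theorems/ByReductionTypeAtTwoSupersingularColemanRoad.lean` (`signedSelmerDual_isTorsion_of_colemanSkeleton`,
"any `p`, any sign"), `Kato2004/DivisibilityInputsFine.lean` (`hYt`), the signed/fine descents of
`Kobayashi2003/*` (where the same statement is the FIELD `EtaColemanPoitouTateData.isTorsion_fine`,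
Kobayashi Cor. 7.2, `a_p = 0`) — none of which the `p ≥ 5`, `ρ̄`-onto fact above can feed at `p ∈ {2, 3}`
or for small image. -/

/-- **Kato 2004, Thm. 12.4 (1) (p. 221) composed with the Poitou–Tate sequence (17.13.1) (p. 279; =
`lim←` over `ℚ(ζ_{p^n})` of (14.9.3), p. 240, with §14.1, p. 235): for EVERY elliptic curve `E/ℚ` and
EVERY prime `p`, the dual fine Selmer group `X₀(E/ℚ_∞) = Sel₀(ℚ_∞, E[p^∞])^∨` over the cyclotomic
`ℤ_p`-extension is a torsion `Λ = ℤ_p⟦T⟧`-module** (`T = γ − 1` for a topological generator `γ`;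
EVERY Pontryagin-dual datum `Y`).  Printed steps: "`𝐇²(T)` is a torsion `Λ`-module" for every stable
lattice `T` of `V_{F_λ}(f)` (12.4 (1), no hypothesis on `p` or on the reduction at `p`), and the exact
sequence (17.13.1) `… → 𝐇¹_loc(T(k))/lim← H¹_f → 𝔛(T*(1−k)) → 𝐇²(T(k)) → 𝐇²_loc(T(k))`, "exact if
`p ≠ 2`, and exact upto `×2` in the case `p = 2`", whose cokernel term at `𝔛` is `X₀` (fine = strict at
`p`; `H¹_f = 0`-condition automatic at `v ∤ p` up the tower), so that `X₀ ↪ 𝐇²(T)` up to a `2`-torsion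
kernel at `p = 2` — torsion is unaffected; tower `ℚ(ζ_{p^∞}) ⊃ ℚ_∞` passage as in
`Kato2004/IwasawaH2Descent.lean` READING (i)/(ii).  PUB-COMPOSITE named fact (cite line ruled by the
ARM P lead, locators confirmed first-hand by the Kato reader; section docstring above); no hypothesis
beyond `E/ℚ`, `p` prime, `κ` cyclotomic with topological generator `γ`.  Finite generation is the tree
THEOREM `WeierstrassCurve.FineSelmerDualData.module_finite` and is not restated.  Nothing asserted; no
`_holds` expected soon (Kato §§13–17, size XL); weaker than print (only the torsion consequence of the
embedding is kept), never stronger.  The scoped refereed sentence of Kim AJM 148 Thm. 4.5 (2) is the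
separate fact `Kim2022_fineSelmerDual_isTorsion` (its special case `p ≥ 5`, `ρ̄` onto).
-- TODO(general form): the comparison map itself, `X₀ →ₗ[Λ] 𝐇²_Γ` injective for `p ≠ 2` with cokernel
-- inside the finite `𝐇²_{Γ,loc}` ((17.13.4)), as a second package over `Kato2004.IwasawaH2Data`;
-- newforms of weight `k ≥ 2` and all twists `T(r)` (Kato's generality; C.-H. Kim arXiv:2505.09121 Thm. 3.16 (2)).
[cite: Kato2004Asterisque, Thm. 12.4 (1) (p. 221); §17.13 (17.13.1) (p. 279); (14.9.3) (p. 240); §14.1 (p. 235)]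
[cite: AlpogeBhargavaShnidman2022, App. A §10.1.1 (the `ℤ_p⟦Γ⟧`-form, arbitrary `E/ℚ` and `p`)] -/
def Kato2004_fineSelmerDual_isTorsion : Prop :=
  ∀ (W : WeierstrassCurve ℚ) [W.IsElliptic] (p : ℕ) [Fact p.Prime]
    (κ : ZpExtension ℚ p) (γ : Field.absoluteGaloisGroup ℚ), κ.IsCyclotomic → κ.IsTopGenerator γ →
    ∀ Y : W.FineSelmerDualData κ γ, Module.IsTorsion (IwasawaAlgebra p) Y.X

/-- Consumer shape of the general fact (the `hY` / `hYt` binders of the fine and signed descents, any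
`p`, any reduction, any image): `X₀(E/ℚ_∞)` is `Λ`-torsion.
[cite: Kato2004Asterisque, Thm. 12.4 (1) (p. 221) and (17.13.1) (p. 279)] -/
theorem fineSelmerDual_isTorsion_of_kato2004 (h : Kato2004_fineSelmerDual_isTorsion)
    (W : WeierstrassCurve ℚ) [W.IsElliptic] (p : ℕ) [Fact p.Prime]
    {κ : ZpExtension ℚ p} {γ : Field.absoluteGaloisGroup ℚ} (hκ : κ.IsCyclotomic)
    (hγ : κ.IsTopGenerator γ) (Y : W.FineSelmerDualData κ γ) :
    Module.IsTorsion (IwasawaAlgebra p) Y.X :=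
  h W p κ γ hκ hγ Y

/-- With the tree theorem `FineSelmerDualData.module_finite`: under the general fact, `X₀(E/ℚ_∞)` is a
finitely generated torsion `Λ`-module for every `E/ℚ` and every prime `p` — Kato's "finitely generated
torsion" for the fine Selmer dual (Burungale–Skinner §10.1.1 wording at every `p`).
[cite: Kato2004Asterisque, (12.2.1) (p. 220), Thm. 12.4 (1) (p. 221) and (17.13.1) (p. 279)]
[cite: AlpogeBhargavaShnidman2022, App. A §10.1.1] -/
theorem fineSelmerDual_finite_and_isTorsion_of_kato2004 (h : Kato2004_fineSelmerDual_isTorsion)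
    (W : WeierstrassCurve ℚ) [W.IsElliptic] (p : ℕ) [Fact p.Prime]
    {κ : ZpExtension ℚ p} {γ : Field.absoluteGaloisGroup ℚ} (hκ : κ.IsCyclotomic)
    (hγ : κ.IsTopGenerator γ) (Y : W.FineSelmerDualData κ γ) :
    Module.Finite (IwasawaAlgebra p) Y.X ∧ Module.IsTorsion (IwasawaAlgebra p) Y.X :=
  ⟨WeierstrassCurve.FineSelmerDualData.module_finite W κ hγ Y, h W p κ γ hκ hγ Y⟩

/-- The general fact CONTAINS the scoped one: under `Kato2004_fineSelmerDual_isTorsion` the conclusion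
of `Kim2022_fineSelmerDual_isTorsion` holds at its `p ≥ 5`, `ρ̄`-onto rows (hypotheses unused) — stated
in binder form (an implication between two named facts, not a discharge of either).
[cite: Kim2022StructureSelmer, Thm. 4.5 (2) (journal) = Thm. 4.6 (2) (arXiv, store chunk p0020:L88–L99)]
[cite: Kato2004Asterisque, Thm. 12.4 (1) (p. 221)] -/
theorem fineSelmerDual_isTorsion_kimRows_of_kato2004 (h : Kato2004_fineSelmerDual_isTorsion)
    (W : WeierstrassCurve ℚ) [W.IsElliptic] (p : ℕ) [Fact p.Prime] (_hp : 5 ≤ p)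
    (_hsurj : W.HasSurjectiveModNGaloisRep p)
    {κ : ZpExtension ℚ p} {γ : Field.absoluteGaloisGroup ℚ} (hκ : κ.IsCyclotomic)
    (hγ : κ.IsTopGenerator γ) (Y : W.FineSelmerDualData κ γ) :
    Module.IsTorsion (IwasawaAlgebra p) Y.X :=
  h W p κ γ hκ hγ Y

end Literature.NumberTheory.EllipticCurves

end
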